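import Literature.RingTheory.KrullDimension.EagonNorthcottMinorsProofs
import Summits.ResolutionOfSingularities.ResolutionOfSingularities.Theorems.EquisingularLiftEquisingularLiftNatCompleteIntersectionLiftAlgebra
import HarnessLib

/-!
# [OURS · L1 W4.5(b) · EL♮(3)] T-DET-PROJ, part 1 (RING CORE): at a smooth point, the lifted determinantal ideal `I_t(M̃)_x` IS the
# complete intersection `(Δ̃ᵢ, Δ̃ⱼ)_x` — Eagon–Northcott replaces Hilbert–Burch for the SMOOTH determinantal nose (rung v6′)

Cell `res-hironaka`, rung L, slot W4.5(b); crux **EL♮(3)** (stmt-ResolutionOfSingularities-20148), rung v6′ «DET-nose» of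
res-L1-w45b-lead-2's LEAD-MEMO-5 §B (ACM / determinantal smooth `Σ ⊂ ℙⁿ_k` = maximal minors of a `(t+1) × t` matrix of forms, expected
codimension 2). Object T-DET-PROJ = «Proj/scheme packaging of the determinantal nose» (THIRD piece of lead-2's cut 2026-08-27T09:34:57Z;
TAKING res-type-097 09:48:24Z). OURS; NOT a statement of any manuscript; AI-written, weaker than expert review. No definition, no `sorry`,
standard axioms. `--supports stmt-ResolutionOfSingularities-20148 --as helper`; it closes nothing by itself.

THE POINT (scheme-free). Let `A` be a regular local ring (the stalk `𝒪_{ℙⁿ_O,x}` at a special point), `ϖ ∈ 𝔪 ∖ 𝔪²` (good reduction),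
`m` a `(t+1) × t` matrix over `A` (germs of the dehomogenised LIFTED entries) with `I_t(m) ⊆ 𝔪` (the point lies on the nose), and
`F = (F₀, F₁)` two elements of `I_t(m) ∩ 𝔪` (germs of two lifted maximal minors) satisfying the DOWNSTAIRS hypothesis of
res-D-pv-027's T-LIFT-CI ring core (p517176) «`Σ aᵢFᵢ ∈ 𝔪² + (ϖ) ⇒ aᵢ ∈ 𝔪`» (= the reductions of `F₀, F₁` have independent
differentials at the point: the determinantal scheme downstairs is SMOOTH OF CODIMENSION 2 there). Then
**`I_t(m) = (F₀, F₁)`** (`minorsIdeal_eq_span_of_cotangentLift`):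
* `(F₀, F₁)` is prime (T-LIFT-CI `CILift.isPrime_span_range_tail`) of height `≥ 2` (chain `⊥ < (F₀) < (F₀, F₁)`, both steps strict by the
  downstairs hypothesis; `two_le_height_span_range`);
* `I_t(m) ⊇ (F₀, F₁)` is a proper determinantal ideal of a `(t+1) × t` matrix, so its height is `≤ (t+1-t+1)(t-t+1) = 2` — the tree's PROVED
  Eagon–Northcott bound `Literature.RingTheory.KrullDimension.height_minorsIdeal_le` (Matsumura Thm. 13.10 / Bruns–Vetter (2.1));
* a prime of finite height equals every ideal above it of no greater height (Mathlib `Ideal.eq_of_le_of_height_le`).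
Consequently pv-027's centre criterion `CILift.isRegular_and_flat_of_cotangentLift` (p518941) applies to the determinantal nose
`C = I_t(M̃)~` VERBATIM with `c = 2` and a point-dependent pair of minors (`exists_cotangentLift_of_pair`, the `∃`-package in exactly its
hypothesis shape): `V(C)` regular and `O`-flat; in particular `ϖ` is regular modulo `I_t(m)` and `(A/I_t(m))/ϖ = (A/ϖ)/I_t(m̄)` — the
conclusions lead-2 booked as (HB-lift) — WITHOUT the Hilbert–Burch complex. Determinantal-ness enters exactly once: the a-priori height
bound UPSTAIRS, which is what forbids `ϖ`-torsion (embedded special components) in the lift. The Hilbert–Burch route (res-type-010 HB-mid /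
res-type-032 HB-lift, p519947) remains the tool for SINGULAR determinantal noses and is not contradicted here.

Also: `minorsIdeal_eq_span_rowMinors` — for a `(t+1) × t` matrix the tree's `minorsIdeal t` (all `t × t` minors over all row/column selections)
is the span of the `t+1` row-deleted minors `det (m.submatrix i.succAbove id)` (res-type-032's `Δᵢ` convention, p519947), so both currencies agree.

References: H. Matsumura, *Commutative Ring Theory* (1986), Thm. 13.10 (Eagon–Northcott), Thms. 14.2–14.3 [Matsumura1987]; W. Bruns,
U. Vetter, *Determinantal Rings*, LNM 1327 (1988), Thm. (2.1) [BrunsVetter1988]; cell: LEAD-MEMO-5 §B (res-L1-w45b-lead-2, OURS).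
-/

set_option linter.dupNamespace false -- mandated namespace `Summit.<Summit>.<Problem>` of this single-conjunct summit

noncomputable section

open IsLocalRing Matrix
open Literature.RingTheory.KrullDimension

namespace Summit.ResolutionOfSingularities.ResolutionOfSingularities.Cruxes.EquisingularLiftNat.Sections

namespace DetLift

universe u

/-! ## §1 The row-deleted minors generate `I_t` of a `(t+1) × t` matrix -/

section RowMinors

variable {A : Type u} [CommRing A] {t : ℕ}

/-- The `i`-th **row-deleted maximal minor** of a `(t+1) × t` matrix lies in `I_t`. [cite: Matsumura1987, Appendix to §13, p. 103] -/
theorem det_submatrix_succAbove_mem_minorsIdeal (m : Matrix (Fin (t + 1)) (Fin t) A) (i : Fin (t + 1)) :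
    (m.submatrix i.succAbove id).det ∈ minorsIdeal t m :=
  det_submatrix_mem_minorsIdeal t m i.succAbove id

/-- A `t × t` minor of a `(t+1) × t` matrix along an arbitrary row selection `ρ` and column selection `γ` is, up to sign, a row-deleted
maximal minor (or zero): it lies in the span of the `t+1` row-deleted minors. [cite: BrunsVetter1988, Ch. 1] -/
theorem det_submatrix_mem_span_rowMinors (m : Matrix (Fin (t + 1)) (Fin t) A) (ρ : Fin t → Fin (t + 1)) (γ : Fin t → Fin t) :
    (m.submatrix ρ γ).det ∈ Ideal.span (Set.range fun i : Fin (t + 1) => (m.submatrix i.succAbove id).det) := by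
  classical
  -- non-injective selections give the zero minor
  by_cases hρ : Function.Injective ρ
  swap
  · rw [det_submatrix_eq_zero_of_not_injective_left m γ hρ]; exact Ideal.zero_mem _
  by_cases hγ : Function.Injective γ
  swap
  · rw [det_submatrix_eq_zero_of_not_injective_right m ρ hγ]; exact Ideal.zero_mem _
  -- `γ` is a permutation of the columns
  have hγb : Function.Bijective γ := Finite.injective_iff_bijective.mp hγ
  set σ : Equiv.Perm (Fin t) := Equiv.ofBijective γ hγb with hσ
  -- the image of `ρ` misses exactly one row `i`
  have hcard : (Finset.univ.image ρ)ᶜ.card = 1 := by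
    rw [Finset.card_compl, Finset.card_image_of_injective _ hρ, Finset.card_univ, Fintype.card_fin, Fintype.card_fin]
    omega
  obtain ⟨i, hi⟩ := Finset.card_eq_one.mp hcard
  have hρi : ∀ j, ρ j ≠ i := by
    intro j h
    have : i ∈ (Finset.univ.image ρ)ᶜ := by rw [hi]; exact Finset.mem_singleton_self i
    rw [Finset.mem_compl] at this
    exact this (Finset.mem_image.mpr ⟨j, Finset.mem_univ _, h⟩)
  -- so `ρ` factors through `i.succAbove` by a permutation `τ`
  have hex : ∀ j, ∃ l, i.succAbove l = ρ j := fun j => Fin.exists_succAbove_eq (hρi j)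
  choose τf hτf using hex
  have hτinj : Function.Injective τf := by
    intro a b hab
    apply hρ
    rw [← hτf a, ← hτf b, hab]
  set τ : Equiv.Perm (Fin t) := Equiv.ofBijective τf (Finite.injective_iff_bijective.mp hτinj) with hτ
  have hsub : m.submatrix ρ γ = (m.submatrix i.succAbove id).submatrix τ σ := by
    ext a b
    simp only [submatrix_apply, id_eq, hτ, hσ, Equiv.ofBijective_apply, hτf]
  rw [hsub]
  -- `det ((N.submatrix τ σ)) = ± det N`
  have hdet : ((m.submatrix i.succAbove id).submatrix (τ : Fin t → Fin t) (σ : Fin t → Fin t)).det =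
      Equiv.Perm.sign σ * Equiv.Perm.sign τ * (m.submatrix i.succAbove id).det := by
    have h1 : (m.submatrix i.succAbove id).submatrix (τ : Fin t → Fin t) (σ : Fin t → Fin t) =
        ((m.submatrix i.succAbove id).submatrix τ id).submatrix id σ := by
      ext a b; rfl
    rw [h1, Matrix.det_permute', Matrix.det_permute]
    ring
  rw [hdet]
  exact Ideal.mul_mem_left _ _ (Ideal.subset_span ⟨i, rfl⟩)

/-- **`I_t(m) = (Δ₀, …, Δ_t)`** for a `(t+1) × t` matrix: the tree's determinantal ideal `minorsIdeal t m` is the span of the `t+1`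
row-deleted maximal minors `Δᵢ = det (m.submatrix i.succAbove id)` (res-type-032's convention). [cite: BrunsVetter1988, Ch. 1] -/
theorem minorsIdeal_eq_span_rowMinors (m : Matrix (Fin (t + 1)) (Fin t) A) :
    minorsIdeal t m = Ideal.span (Set.range fun i : Fin (t + 1) => (m.submatrix i.succAbove id).det) := by
  apply le_antisymm
  · rw [minorsIdeal_def, Ideal.span_le]
    rintro _ ⟨e, rfl⟩
    exact det_submatrix_mem_span_rowMinors m e.1 e.2
  · rw [Ideal.span_le]
    rintro _ ⟨i, rfl⟩
    exact det_submatrix_succAbove_mem_minorsIdeal m i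

end RowMinors

/-! ## §2 Eagon–Northcott pins a proper `(t+1) × t` determinantal ideal to any height-`≥ 2` prime below it -/

section EagonNorthcott

variable {A : Type u} [CommRing A] [IsNoetherianRing A] {t : ℕ}

/-- Eagon–Northcott for the maximal minors of a `(t+1) × t` matrix: a proper `I_t(m)` has height `≤ 2`.
[cite: Matsumura1987, Thm. 13.10] [cite: BrunsVetter1988, Thm. (2.1)] -/
theorem height_minorsIdeal_le_two (m : Matrix (Fin (t + 1)) (Fin t) A) (hm : minorsIdeal t m ≠ ⊤) :
    (minorsIdeal t m).height ≤ 2 := by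
  have h := height_minorsIdeal_le t m hm
  have h2 : (t + 1 - t + 1) * (t - t + 1) = 2 := by
    rw [Nat.add_sub_cancel_left, Nat.sub_self]
  rw [h2] at h
  exact_mod_cast h

/-- **A proper `(t+1) × t` determinantal ideal containing a prime of height `≥ 2` EQUALS that prime** (Eagon–Northcott: `ht I_t(m) ≤ 2`;
a prime of finite height equals any ideal above it of no greater height). [cite: Matsumura1987, Thm. 13.10] -/
theorem minorsIdeal_eq_of_isPrime_le (m : Matrix (Fin (t + 1)) (Fin t) A) {P : Ideal A} [P.IsPrime]
    (hP : P ≤ minorsIdeal t m) (hm : minorsIdeal t m ≠ ⊤) (h2 : 2 ≤ P.height) : minorsIdeal t m = P :=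
  (P.eq_of_le_of_height_le hP ((height_minorsIdeal_le_two m hm).trans h2)).symm

end EagonNorthcott

/-! ## §3 The height of a cotangent-independent pair -/

section PairLocal

variable {R : Type u} [CommRing R] [IsLocalRing R] {ϖ : R} {F : Fin 2 → R}
  (hdown : ∀ a : Fin 2 → R, ∑ i, a i * F i ∈ maximalIdeal R ^ 2 ⊔ Ideal.span {ϖ} → ∀ i, a i ∈ maximalIdeal R)

include hdown in
/-- Under the downstairs hypothesis, `F₀ ≠ 0` (else `a = (1, 0)` would force `1 ∈ 𝔪`). [folklore] -/
theorem pair_fst_ne_zero : F 0 ≠ 0 := by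
  intro h0
  have h := hdown ![1, 0] (by simp [Fin.sum_univ_two, h0]) 0
  simp only [Matrix.cons_val_zero] at h
  exact (maximalIdeal.isMaximal R).ne_top (Ideal.eq_top_of_isUnit_mem _ h isUnit_one)

include hdown in
/-- Under the downstairs hypothesis, `F₁ ∉ (F₀)` (else `a = (b, -1)` would force `-1 ∈ 𝔪`). [folklore] -/
theorem pair_snd_not_mem_span : F 1 ∉ Ideal.span {F 0} := by
  intro h1
  obtain ⟨b, hb⟩ := Ideal.mem_span_singleton'.mp h1
  have h := hdown ![b, -1] (by simp [Fin.sum_univ_two, hb]) 1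
  simp only [Matrix.cons_val_one, Matrix.cons_val_fin_one] at h
  exact (maximalIdeal.isMaximal R).ne_top (Ideal.eq_top_of_isUnit_mem _ h isUnit_one.neg)

end PairLocal

section Pair

variable {R : Type u} [CommRing R] [IsRegularLocalRing R] {ϖ : R} (hϖ : ϖ ∈ maximalIdeal R)
  (hϖ2 : ϖ ∉ maximalIdeal R ^ 2) {F : Fin 2 → R} (hF : ∀ i, F i ∈ maximalIdeal R)
  (hdown : ∀ a : Fin 2 → R, ∑ i, a i * F i ∈ maximalIdeal R ^ 2 ⊔ Ideal.span {ϖ} → ∀ i, a i ∈ maximalIdeal R)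

include hϖ hϖ2 hF hdown in
/-- **`(F₀, F₁)` is a prime of height `≥ 2`**: the chain `⊥ < (F₀) < (F₀, F₁)` of primes (regular local rings are domains; `(F₀)` and
`(F₀, F₁)` are prime by T-LIFT-CI's `isPrime_span_image_of_linearIndependent_toCotangent` / `isPrime_span_range_tail`).
[cite: Matsumura1987, Thms. 14.2–14.3] -/
theorem two_le_height_span_range : 2 ≤ (Ideal.span (Set.range F)).height := by
  haveI : IsDomain R := Literature.AlgebraicGeometry.Resolution.isDomain_of_isRegularLocalRing R
  -- `(F₀)` is prime: the sub-image `{succ 0}` of the cotangent-independent family `(ϖ, F₀, F₁)`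
  have hp1 : (Ideal.span {F 0}).IsPrime := by
    have h := Literature.AlgebraicGeometry.Resolution.isPrime_span_image_of_linearIndependent_toCotangent _
      (CILift.cons_mem_maximalIdeal hϖ hF) (CILift.linearIndependent_toCotangent_cons hϖ hϖ2 hF hdown) {Fin.succ 0}
    rwa [Set.image_singleton, Fin.cons_succ] at h
  haveI hp2 : (Ideal.span (Set.range F)).IsPrime := CILift.isPrime_span_range_tail hϖ hϖ2 hF hdown
  -- strict chain `⊥ < (F₀) < (F₀, F₁)`
  have hlt1 : (⊥ : Ideal R) < Ideal.span {F 0} := by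
    rw [bot_lt_iff_ne_bot, ne_eq, Ideal.span_singleton_eq_bot]
    exact pair_fst_ne_zero hdown
  have hlt2 : Ideal.span {F 0} < Ideal.span (Set.range F) := by
    refine lt_of_le_of_ne (Ideal.span_mono (by rintro _ rfl; exact ⟨0, rfl⟩)) fun heq => ?_
    have : F 1 ∈ Ideal.span {F 0} := by rw [heq]; exact Ideal.subset_span ⟨1, rfl⟩
    exact pair_snd_not_mem_span hdown this
  haveI : (⊥ : Ideal R).IsPrime := Ideal.isPrime_bot
  haveI := hp1
  have h1 : (1 : ℕ∞) ≤ (Ideal.span {F 0}).height := by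
    have h := Ideal.height_add_one_le_of_lt_of_isPrime hlt1
    rw [Ideal.height_bot, zero_add] at h
    exact h
  have h2 := Ideal.height_add_one_le_of_lt_of_isPrime hlt2
  calc (2 : ℕ∞) = 1 + 1 := by norm_num
    _ ≤ (Ideal.span {F 0}).height + 1 := by gcongr
    _ ≤ _ := h2

end Pair

/-! ## §4 The determinantal stalk ideal at a smooth point is the complete intersection of two lifted minors -/

section Main

variable {R : Type u} [CommRing R] [IsRegularLocalRing R] {t : ℕ} (m : Matrix (Fin (t + 1)) (Fin t) R)
  {ϖ : R} (hϖ : ϖ ∈ maximalIdeal R) (hϖ2 : ϖ ∉ maximalIdeal R ^ 2)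
  {F : Fin 2 → R} (hF : ∀ i, F i ∈ maximalIdeal R)
  (hdown : ∀ a : Fin 2 → R, ∑ i, a i * F i ∈ maximalIdeal R ^ 2 ⊔ Ideal.span {ϖ} → ∀ i, a i ∈ maximalIdeal R)
  (hFm : ∀ i, F i ∈ minorsIdeal t m) (hm : minorsIdeal t m ≤ maximalIdeal R)

include hϖ hϖ2 hF hdown hFm hm in
/-- **T-DET-PROJ RING CORE: `I_t(m) = (F₀, F₁)`.** `R` regular local, `ϖ ∈ 𝔪 ∖ 𝔪²`; `m` a `(t+1) × t` matrix over `R` with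
`I_t(m) ⊆ 𝔪`; `F₀, F₁ ∈ I_t(m) ∩ 𝔪` with the downstairs hypothesis «`Σ aᵢFᵢ ∈ 𝔪² + (ϖ) ⇒ aᵢ ∈ 𝔪`». Then the determinantal ideal IS
the complete intersection `(F₀, F₁)` (Eagon–Northcott height `≤ 2` against the height-`2` prime `(F₀, F₁)`).
[cite: Matsumura1987, Thm. 13.10 with Thms. 14.2–14.3] -/
theorem minorsIdeal_eq_span_of_cotangentLift : minorsIdeal t m = Ideal.span (Set.range F) := by
  haveI : (Ideal.span (Set.range F)).IsPrime := CILift.isPrime_span_range_tail hϖ hϖ2 hF hdown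
  refine minorsIdeal_eq_of_isPrime_le m (Ideal.span_le.mpr ?_) ?_ (two_le_height_span_range hϖ hϖ2 hF hdown)
  · rintro _ ⟨i, rfl⟩; exact hFm i
  · exact fun htop => (maximalIdeal.isMaximal R).ne_top (top_le_iff.mp (htop ▸ hm))

include hϖ hϖ2 hF hdown hFm hm in
/-- **The `∃`-package in the exact hypothesis shape of T-LIFT-CI's centre criterion** `CILift.isRegular_and_flat_of_cotangentLift`
(p518941): the determinantal stalk ideal is generated by a finite family in `𝔪` satisfying the downstairs hypothesis.
[cite: Matsumura1987, Thm. 13.10 with Thms. 14.2–14.3] -/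
theorem exists_cotangentLift_of_pair :
    ∃ (c : ℕ) (G : Fin c → R), minorsIdeal t m = Ideal.span (Set.range G) ∧ (∀ i, G i ∈ maximalIdeal R) ∧
      ∀ a : Fin c → R, ∑ i, a i * G i ∈ maximalIdeal R ^ 2 ⊔ Ideal.span {ϖ} → ∀ i, a i ∈ maximalIdeal R :=
  ⟨2, F, minorsIdeal_eq_span_of_cotangentLift m hϖ hϖ2 hF hdown hFm hm, hF, hdown⟩

include hϖ hϖ2 hF hdown hFm hm in
/-- By-product (the booked (HB-lift) conclusions, without the complex): **`R / I_t(m)` is a regular local ring** …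
[cite: Matsumura1987, Thm. 14.2] -/
theorem isRegularLocalRing_quotient_minorsIdeal : IsRegularLocalRing (R ⧸ minorsIdeal t m) := by
  rw [minorsIdeal_eq_span_of_cotangentLift m hϖ hϖ2 hF hdown hFm hm]
  exact CILift.isRegularLocalRing_quotient_span_range_tail hϖ hϖ2 hF hdown

include hϖ hϖ2 hF hdown hFm hm in
/-- … **`ϖ` is a non-zero-divisor modulo `I_t(m)`** (the lifted nose is `O`-FLAT at the point) …
[cite: Matsumura1987, Thm. 14.2 with Thm. 14.3] -/
theorem mem_minorsIdeal_of_mul_mem (y : R) (hy : ϖ * y ∈ minorsIdeal t m) : y ∈ minorsIdeal t m := by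
  rw [minorsIdeal_eq_span_of_cotangentLift m hϖ hϖ2 hF hdown hFm hm] at hy ⊢
  exact CILift.mem_span_range_of_mul_mem hϖ hϖ2 hF hdown y hy

include hϖ hϖ2 hF hdown hFm hm in
/-- … and **the special fibre `R / (I_t(m) + (ϖ))` of the lifted nose at the point is a regular local ring**.
[cite: Matsumura1987, Thm. 14.2] -/
theorem isRegularLocalRing_quotient_minorsIdeal_sup_span :
    IsRegularLocalRing (R ⧸ (minorsIdeal t m ⊔ Ideal.span {ϖ})) := by
  rw [minorsIdeal_eq_span_of_cotangentLift m hϖ hϖ2 hF hdown hFm hm]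
  exact CILift.isRegularLocalRing_quotient_span_range_cons hϖ hϖ2 hF hdown

end Main

end DetLift

end Summit.ResolutionOfSingularities.ResolutionOfSingularities.Cruxes.EquisingularLiftNat.Sections

end
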